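import Literature.MathematicalPhysics.QuantumFieldTheory.Balaban1983to89.B8Thm2T3FamilyBinder

/-!
# `Balaban1983to89.B8Thm2TorusKnitCubeCore` — M5.9 ASSEMBLY, FILE A14: the analytic cube data WITHOUT its three bookkeeping fields — the record
# `KnitCubeCore` (= file A10's `KnitCubeAnalytic` minus the section property `hι`, print's units `hcf : c_f = Lᵏ` and the unit `hs : η_S⁴s = 1`, which
# the member catalogue of file A11 supplies) — and the endpoints of files A12 ∕ A13 re-issued with EXACTLY [Balaban1985BackgroundPropagators]'s Thm-3.7 ∕
# Thm-3.9 cube data and the (B)-lines displayed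

T. Bałaban, *Propagators for lattice gauge theories in a background field*, Commun. Math. Phys. **99** (1985) 389–434 [Balaban1985BackgroundPropagators] («[B9]»),
THM 3.7 (3.87)–(3.90) pp. 409–410, COR. 3.6 p. 408, THM 3.9 p. 413, (3.95)–(3.96) p. 411, THM 3.1 (3.42) p. 397, THM 3.2 (3.48) p. 398; T. Bałaban, *Spaces of
regular gauge field configurations on a lattice and gauge fixing conditions*, Commun. Math. Phys. **99** (1985) 75–102 [Balaban1985RegularSpaces] («[B8]»), THM 2
p. 83; [Balaban1985UV3] (1)–(3) p. 256; [Balaban1985Variational] (2), (5) p. 278; [Balaban1984PropagatorsII] (2.1)–(2.4) p. 224, Lemma 2.1 p. 234.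

Sub-row G-B8-T2S «[B8] §3 Thm 2 TORUS SUPPLIER» (unit `lit-balaban-t2s-1`, gen 5).  Files A12 ∕ A13 display, per member `i = mem P₀ n` and background, the
hypothesis `Nonempty (KnitCubeAnalytic i U b ιB Rr Hp p η_S⁻⁴)`; three of that record's fields are NOT analytic: `hι` (the catalogue's `ιBm` is a section of
`β` — clause 1 of the catalogue spec), `hcf` (`c_f = Lᵏ` — clause 1) and `hs` (`η_S⁴·η_S⁻⁴ = 1`).  THIS FILE removes them from the suppliers' target:

* §1 **`KnitCubeCore i U b ιB Rr Hp p`** — the analytic fields of `KnitCubeAnalytic` VERBATIM (M5.5: cubes, supports, cube terms `T_□`, remainders `R_□`,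
  left entries, Cor.-3.6 majorants `hT`, (3.89) `h389`, (3.88) `h388`, `hTE`, `hKE`, counts; M5.6: cube letters `Oc`, cut-offs `h_□, χ_□`, supports,
  local inverses `Cl` with the local inverse property `hloc`, per-cube (3.48) blocks `hC` AT THE UNIT `s = η_S⁻⁴`, [2]-difference majorants `hD` (GAP
  G-B9-05), site majorants `hGc`, separation, slow variation), and **`KnitCubeAnalytic.ofCore`** (`hι`, `hcf` + core ⟹ the record of file A10, `hs` by
  `η_S > 0`).
* §2 ★★★★★★★ **`thm2SetupSUAt_catalogued_exists_of_core`** — file A12's endpoint with `Nonempty (KnitCubeCore …)` in place of `Nonempty (KnitCubeAnalytic …)`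
  (general `d + 1 ≥ 2`, `N ≤ 25`).
* §3 ★★★★★★★ **`hThm2_of_core`** — file A13's consumer-vocabulary binder likewise: ∀ `F : T3Family`, `F.L = ℓ + 1` → `k₀ ≤ F.m` → ∀ `n < K` → [core cube
  data at `η = L^{−(K−n)}`] → [(B)-lines] → `∃ β₀ B₂′ len′, Thm2SetupSUAt (F.P K) 2 (K − n) (eta F n K) β₀ B₁ B₂′ c₁ len′ (fun _ => True)`, `B₁, c₁` uniform.

HONEST SCOPE.  Plumbing only; NO estimate of [B8]∕[B9] is proved; the core cube data (owners M5.1b∕c, M5.2, M5.4, M5.5, M5.6 — p21 ∕ p33 ∕ p38 lineages)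
and the (B)-lines (r05 M5.7∕M5.8) stay DISPLAYED antecedents, inhabited by nothing here; the located volume threshold `k₀ ≤ F.m` (resp. `k + k₀ ≤ m + K`)
and `L ≥ 5` stand; count-neutral; N05 ∕ `stub_PV3A` NOT discharged; nothing continuum ∕ ℝ⁴ ∕ OS ∕ mass-gap ∕ Clay — the Yang–Mills mass gap is NOT proved.
No `sorry`, no `axiom`, no `… : Prop` fact (the `structure … : Type 1` is a hypothesis SHAPE with all fields displayed, as in files A4∕A8∕A10), no
`instance`, no `notation`.  NEW file; nothing landed is modified.  Seat `lit-balaban-t2s-1` gen 5, 2026-08-28.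
-/

noncomputable section

open scoped BigOperators

namespace Literature.MathematicalPhysics.QuantumFieldTheory.Balaban1983to89.B8Thm2TorusKnitCubeCore

open Node00 B6KLevelCensusIndexV1 B6Geom246MultiLevelBox B9BackgroundsKLevelV1 B9Eq39Adjoint B9Thm311ReadingCoords B9Thm311DeltaPrimePos
open B7Prop1Explicit renaming Site → LSite
open B7Prop1Explicit (e)
open B6RandomWalk (HasMajorant)
open B9Thm34Ext (toB6)
open B9GeoNormsKLevelV1 (geo9K)
open B9Eq352DivFormLetters (conj)
open B9Eq352GradLetters (diffLetter)
open B9Thm37CubeCoverCommutators (cutMulY)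
open B9Ineq349SiteComposite (etaS_pos)
open B6GlobalChartV1 (PV)
open B6Ineq2142KLevelV1 (β)
open B9B8AveragingJunction (parKnitY)
open B8Ineq132 (InAk)
open B8Thm2TorusLettersPerOfKnit (bgY)
open B8Thm2TorusKnitEstimatesOfMajorants (B9P3PerAt)
open B8Thm2TorusKnitMajorantsOfCubes (KnitCubeParams)
open B8Thm2TorusKnitCubeGeometry (KnitCubeAnalytic)
open B8Thm2TorusKnitParamsExist (thm2SetupSUAt_catalogued_exists_of_constants)
open B8Thm2T3FamilyBinder (P_eq_PV)
open B7Prop2SpecialUnitary (specialUnitaryUnits)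
open B8Thm2SetupTorus (Thm2SetupSUAt)
open T3ContinuumYM3Torus (T3Family)
open T3SectALandauChart (eta eta_pos)
open scoped Matrix Matrix.Norms.L2Operator

variable {d ℓ : ℕ} {hd : 1 ≤ d + 1} {hL : Odd (ℓ + 1) ∧ 1 < ℓ + 1} {b₀ b₁ : ℝ}

/-! ## §1 The core of the analytic cube data -/

section Core

variable {N : ℕ} (i : KIdx d ℓ hd hL b₀ b₁) (U : CfgY (Matrix (Fin N) (Fin N) ℂ) i)
variable {ι : Type} [Fintype ι] (b : Module.Basis ι ℝ (Matrix (Fin N) (Fin N) ℂ))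
variable [Fintype (geo9K i).Site] [DecidableEq (geo9K i).Site] (ιB : BlkY i → IBondY i) (Rr : ℝ) (Hp : Prop) (p : KnitCubeParams)

/-- **THE CORE OF THE ANALYTIC CUBE DATA AT ONE MEMBER AND ONE BACKGROUND** — file A10's `KnitCubeAnalytic i U b ιB Rr Hp p s` minus its three bookkeeping
fields (`hι`, `hcf`, `hs`), the per-cube (3.48) blocks read at the unit `s = η_S⁻⁴`: M5.5's [B9] Thm-3.7 cube data at def-Y's letter of record `parSymY` and
M5.6's [B9] Thm-3.9 per-cube data at print's transporters `parKnitY`, every field VERBATIM.  A hypothesis SHAPE (owners: M5.1b∕c, M5.2, M5.4, M5.5, M5.6).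
[cite: Balaban1985BackgroundPropagators, Thm 3.7 (3.87)–(3.90) pp.409–410, Cor 3.6 p.408, Thm 3.9 p.413, (3.95)–(3.96) p.411, Thm 3.1 (3.42) p.397, Thm 3.2 (3.48) p.398; Balaban1984PropagatorsII, (2.52) p.233] -/
structure KnitCubeCore : Type 1 where
  /-- the index type of M5.5's cubes. -/
  κ : Type
  /-- it is finite. -/
  [instκ : Fintype κ]
  /-- supports of the cube terms. -/
  SG : κ → Finset (geo9K i).Site
  /-- supports of the remainders. -/
  SG' : κ → Finset (geo9K i).Site
  /-- the cube terms `T_□`. -/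
  T : κ → Module.End ℝ (SiteY i → Matrix (Fin N) (Fin N) ℂ)
  /-- the remainders `R_□`. -/
  R : κ → Module.End ℝ (SiteY i → Matrix (Fin N) (Fin N) ℂ)
  /-- the left-entry block majorants `K_{E,□}^μ`. -/
  KE : Fin (d + 1) → κ → (geo9K i).Site → (geo9K i).Site → ℝ
  /-- Cor. 3.6 block majorants of the cube terms. -/
  hT : ∀ k, HasMajorant (g := toB6 (geo9K i) Rr Hp) (fun q : SiteY i × ι => ιB (blkOf i.D.toDomains q.1)) (conj b ((etaS i ^ 2) • T k))
    (fun a a' => if a ∈ SG k then p.BG₀ * (geo9K i).len a ^ 2 * Real.exp (-(p.δG₀ * (geo9K i).dist a a')) else 0)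
  /-- overlap count of the cube supports. -/
  hcntG : ∀ a : (geo9K i).Site, (∑ k, if a ∈ SG k then (1 : ℝ) else 0) ≤ p.NG
  /-- the left entries of the cube terms, every direction. -/
  hTE : ∀ (μ : Fin (d + 1)) k, HasMajorant (g := toB6 (geo9K i) Rr Hp) (fun q : SiteY i × ι => ιB (blkOf i.D.toDomains q.1))
    (conj b (diffLetter (shiftY i) (UboxY i U) ((((etaS i : ℝ) : ℂ))⁻¹) (Sum.inl μ)) * conj b ((etaS i ^ 2) • T k)) (KE μ k)
  /-- their sum is a (3.42)₂-shape majorant. -/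
  hKE : ∀ (μ : Fin (d + 1)) a a', (∑ k, KE μ k a a') ≤ p.AE * (geo9K i).len a * Real.exp (-(p.δG₀ * (geo9K i).dist a a'))
  /-- (3.89) majorants of the remainders. -/
  h389 : ∀ k, HasMajorant (g := toB6 (geo9K i) Rr Hp) (fun q : SiteY i × ι => ιB (blkOf i.D.toDomains q.1)) (conj b (R k))
    (fun a a' => if a ∈ SG' k then p.θG * Real.exp (-(p.δG₀ * (geo9K i).dist a a')) else 0)
  /-- overlap count of the remainder supports. -/
  hcntG' : ∀ a : (geo9K i).Site, (∑ k, if a ∈ SG' k then (1 : ℝ) else 0) ≤ p.NG'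
  /-- (3.88): `Δ′_a(U; parSymY)·ΣT_□ = 1 − ΣR_□`. -/
  h388 : (deltaPrimeAY i (parSymY i) U).restrictScalars ℝ * (∑ k, T k) = 1 - ∑ k, R k
  /-- the index type of M5.6's cubes. -/
  κι : Type
  /-- it is finite. -/
  [instκι : Fintype κι]
  /-- the cube letters `G′_□(·)`. -/
  Oc : κι → SiteOpY (Matrix (Fin N) (Fin N) ℂ) i
  /-- the `χ_□ = 1` cores. -/
  Sχ : κι → Finset (geo9K i).Site
  /-- the supports of `h_□`. -/
  Sk : κι → Finset (geo9K i).Site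
  /-- the cut-offs `χ_□`. -/
  χ : κι → BlkY i → ℝ
  /-- the partition of unity `h_□`. -/
  h : κι → BlkY i → ℝ
  /-- the local inverses `C_□`. -/
  Cl : κι → Module.End ℝ (BlkY i → Matrix (Fin N) (Fin N) ℂ)
  /-- (3.42)₁-shape site majorants of the cube letters at the common amplitude∕rate. -/
  hGc : ∀ k, HasMajorant (g := toB6 (geo9K i) Rr Hp) (fun q : SiteY i × ι => ιB (blkOf i.D.toDomains q.1))
    (conj b ((etaS i ^ 2) • (Oc k U).restrictScalars ℝ)) (fun a a' => p.A * (geo9K i).len a ^ 2 * Real.exp (-(p.δG * (geo9K i).dist a a')))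
  /-- `Σ_□ h_□² = 1`. -/
  hsq : ∀ t, ∑ k, h k t ^ 2 = 1
  /-- `|h_□| ≤ 1`. -/
  hh : ∀ k t, |h k t| ≤ 1
  /-- `supp h_□ ⊂ S_□`. -/
  hS : ∀ k t, h k t ≠ 0 → ιB t ∈ Sk k
  /-- overlap count of M5.6's cover. -/
  hcnt : ∀ a : (geo9K i).Site, (∑ k, if a ∈ Sk k then (1 : ℝ) else 0) ≤ p.Nn
  /-- `0 ≤ χ_□ ≤ 1`. -/
  hχ01 : ∀ k t, 0 ≤ χ k t ∧ χ k t ≤ 1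
  /-- `χ_□ = 1` on the core. -/
  hχS : ∀ k t, ιB t ∈ Sχ k → χ k t = 1
  /-- separation of the core's complement from `supp h_□`. -/
  hsep : ∀ k a, a ∉ Sχ k → ∀ a'' ∈ Sk k, p.Dsep ≤ (geo9K i).dist a a''
  /-- slow variation of `h_□`. -/
  hLip : ∀ k (t t' : BlkY i), |h k t' - h k t| ≤ p.ℓ₀ + p.ℓ₁ * (geo9K i).dist (ιB t) (ιB t')
  /-- the local inverse property (M5.2-E). -/
  hloc : ∀ k, (cutMulY (𝔸 := Matrix (Fin N) (Fin N) ℂ) (h k)).restrictScalars ℝ *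
    ((cutMulY (𝔸 := Matrix (Fin N) (Fin N) ℂ) (χ k)).restrictScalars ℝ * (XY i (parKnitY i) (Oc k) U).restrictScalars ℝ) * Cl k *
      (cutMulY (𝔸 := Matrix (Fin N) (Fin N) ℂ) (h k)).restrictScalars ℝ =
    (cutMulY (𝔸 := Matrix (Fin N) (Fin N) ℂ) (h k)).restrictScalars ℝ * (cutMulY (𝔸 := Matrix (Fin N) (Fin N) ℂ) (h k)).restrictScalars ℝ
  /-- the per-cube (3.48) blocks of `C_□`. -/
  hC : ∀ k, HasMajorant (g := toB6 (geo9K i) Rr Hp) (fun q : BlkY i × ι => ιB q.1) (conj b ((etaS i ^ 2 * etaS i ^ 2)⁻¹ • Cl k))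
    (fun a a' => if a ∈ Sk k then p.B₀ * ((geo9K i).len a ^ 4)⁻¹ * Real.exp (-(p.bb * p.δ₀ * (geo9K i).dist a a')) else 0)
  /-- the [2]-difference majorants (GAP G-B9-05). -/
  hD : ∀ k, HasMajorant (g := toB6 (geo9K i) Rr Hp) (fun q : BlkY i × ι => ιB q.1)
    (conj b ((etaS i ^ 2 * etaS i ^ 2) • ((XY i (parKnitY i) (GpY i (parKnitY i)) U).restrictScalars ℝ - (XY i (parKnitY i) (Oc k) U).restrictScalars ℝ)))
    (fun a a'' => p.κD * Real.exp (-(2 * p.δ₀ * p.Dsep)) * (geo9K i).len a ^ 4 * Real.exp (-(p.aD * p.δ₀ * (geo9K i).dist a a'')))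

variable {i U b ιB Rr Hp p}

/-- **FILE A10's RECORD FROM ITS CORE** and the catalogue's bookkeeping (`ιB` a section of `β`, `c_f = Lᵏ`; `η_S⁴·η_S⁻⁴ = 1` by `η_S > 0`).
[cite: Balaban1985BackgroundPropagators, Thm 3.7 pp.409–410, Thm 3.9 p.413, bookkeeping] -/
def _root_.Literature.MathematicalPhysics.QuantumFieldTheory.Balaban1983to89.B8Thm2TorusKnitCubeGeometry.KnitCubeAnalytic.ofCore
    (hι : ∀ t, B6Ineq2142KLevelV1.β i.hN i.D i.hk (ιB t) = t) (hcf : i.cf = (((ℓ + 1 : ℕ) : ℝ)) ^ i.k) (core : KnitCubeCore i U b ιB Rr Hp p) :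
    KnitCubeAnalytic i U b ιB Rr Hp p ((etaS i ^ 2 * etaS i ^ 2)⁻¹) :=
  letI : Fintype core.κ := core.instκ
  letI : Fintype core.κι := core.instκι
  { hι := hι
    hcf := hcf
    hs := mul_inv_cancel₀ (mul_pos (pow_pos (etaS_pos i) 2) (pow_pos (etaS_pos i) 2)).ne'
    κ := core.κ
    SG := core.SG
    SG' := core.SG'
    T := core.T
    R := core.R
    KE := core.KE
    hT := core.hT
    hcntG := core.hcntG
    hTE := core.hTE
    hKE := core.hKE
    h389 := core.h389
    hcntG' := core.hcntG'
    h388 := core.h388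
    κι := core.κι
    Oc := core.Oc
    Sχ := core.Sχ
    Sk := core.Sk
    χ := core.χ
    h := core.h
    Cl := core.Cl
    hGc := core.hGc
    hsq := core.hsq
    hh := core.hh
    hS := core.hS
    hcnt := core.hcnt
    hχ01 := core.hχ01
    hχS := core.hχS
    hsep := core.hsep
    hLip := core.hLip
    hloc := core.hloc
    hC := core.hC
    hD := core.hD }

end Core

/-! ## §2 ★★★★★★★ File A12's endpoint with the core cube data displayed -/

section Endpoint

variable {N : ℕ} [NeZero N]
variable [instF : ∀ i : KIdx d ℓ hd hL b₀ b₁, Fintype (geo9K i).Site] [∀ i : KIdx d ℓ hd hL b₀ b₁, DecidableEq (geo9K i).Site]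

/-- ★★★★★★★ **[B8] THM 2 AT THE `SU(N)`-VALUED SETUP-TORUS OBJECTS OF EVERY `PV d ℓ m K` WITH `k + k₀ ≤ m + K`, FROM THE CORE CUBE DATA AND THE (B)-LINES**
— file A12's `thm2SetupSUAt_catalogued_exists_of_constants` with the per-member hypothesis `Nonempty (KnitCubeCore (mem P₀ n) (bgY … U₀) b (ιBm P₀ n) Rr Hp p)`
([B9] Thm-3.7 ∕ Thm-3.9 cube data only; the section property and `c_f = Lᵏ` come from the catalogue spec, clause 1).  The two arrows' antecedents stay
displayed, inhabited by nothing here; located volume threshold `k + k₀ ≤ m + K`; no estimate of [B8]∕[B9] proved; `stub_PV3A` NOT discharged; the Yang–Mills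
mass gap is NOT proved.
[cite: Balaban1985RegularSpaces, Thm 2 p.83 («there exists B₁»), (1.33)–(1.39) pp.82–83; Balaban1985BackgroundPropagators, Thm 3.7 p.410 («for M sufficiently large»), Thm 3.9 p.413; Balaban1984PropagatorsII, (2.1)–(2.4) p.224, Lemma 2.1 p.234] -/
theorem thm2SetupSUAt_catalogued_exists_of_core (hN : N ≤ 25) (hd2 : 2 ≤ d + 1) (hℓ : 4 ≤ ℓ) (hb₀ : 0 < b₀) (hb₁ : b₀ ≤ b₁)
    {B₀ B₀β cB9 βH : ℝ} {len : LSite (d + 1) → ℝ}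
    (hB₀ : 0 < B₀) (hB : 2 ≤ 5 * ((d + 1 : ℕ) : ℝ) * ((ℓ + 1 : ℕ) : ℝ) * B₀) (hcB9 : 0 < cB9)
    {ι : Type} [Fintype ι] [DecidableEq ι] (b : Module.Basis ι ℝ (Matrix (Fin N) (Fin N) ℂ)) {M₂ : ℝ} (hM₂ : 0 ≤ M₂)
    (hrepr : ∀ (v : Matrix (Fin N) (Fin N) ℂ) (j : ι), |b.repr v j| ≤ M₂ * ‖v‖)
    {BG₀ δG₀ NG NG' AE Ac δc BC δC Nn κD : ℝ} (hBG₀ : 0 ≤ BG₀) (hδG₀ : 0 < δG₀) (hNG : 0 ≤ NG) (hNG' : 0 ≤ NG')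
    (hAE : 0 ≤ AE) (hAc : 0 ≤ Ac) (hδc : 0 < δc) (hBC : 0 ≤ BC) (hδC : 0 < δC) (hNn : 0 ≤ Nn) (hκD : 0 ≤ κD) (Rr : ℝ) (Hp : Prop) :
    letI : CStarAlgebra (Matrix (Fin N) (Fin N) ℂ) := {}
    ∃ θs ℓs Ds cL A δG δ₀ : ℝ, 0 < θs ∧ 0 < ℓs ∧ 0 < cL ∧ Ac ≤ A ∧ 0 < δG ∧ δG ≤ δc ∧ 0 < δ₀ ∧ δ₀ ≤ δC ∧
      ∀ θG ℓ₀ ℓ₁ Dsep : ℝ, 0 ≤ θG → θG ≤ θs → 0 ≤ ℓ₀ → ℓ₀ ≤ ℓs → 0 ≤ ℓ₁ → ℓ₁ ≤ ℓs → Ds ≤ Dsep →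
        ∃ p : KnitCubeParams,
          (p.BG₀ = BG₀ ∧ p.δG₀ = δG₀ ∧ p.NG = NG ∧ p.NG' = NG' ∧ p.AE = AE ∧ p.θG = θG ∧ p.A = A ∧ p.δG = δG ∧
            p.B₀ = BC ∧ p.δ₀ = δ₀ ∧ p.bb = 1 ∧ p.aD = 1 ∧ p.Nn = Nn ∧ p.κD = κD ∧ p.Dsep = Dsep ∧ p.ℓ₀ = ℓ₀ ∧ p.ℓ₁ = ℓ₁) ∧
        ∃ (k₀ : ℕ) (mem : ℤ → ℕ → KIdx d ℓ hd hL b₀ b₁) (ιBm : ∀ P n, BlkY (mem P n) → IBondY (mem P n)) (B₁ B₂ c₁ : ℝ),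
          0 < B₁ ∧ 0 < B₂ ∧ 0 < c₁ ∧
          (∀ (m K n : ℕ), 1 ≤ n → n + k₀ ≤ m + K →
            (mem (((PV d ℓ m K hd hL).sitesPerDir 0 : ℕ) : ℤ) n).m = m + K ∧ (mem (((PV d ℓ m K hd hL).sitesPerDir 0 : ℕ) : ℤ) n).K = 0 ∧
            (mem (((PV d ℓ m K hd hL).sitesPerDir 0 : ℕ) : ℤ) n).k = n + 1 ∧
            (mem (((PV d ℓ m K hd hL).sitesPerDir 0 : ℕ) : ℤ) n).cf = (((ℓ + 1 : ℕ) : ℝ)) ^ (mem (((PV d ℓ m K hd hL).sitesPerDir 0 : ℕ) : ℤ) n).k ∧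
            (∀ z : SiteY (mem (((PV d ℓ m K hd hL).sitesPerDir 0 : ℕ) : ℤ) n), levY (mem (((PV d ℓ m K hd hL).sitesPerDir 0 : ℕ) : ℤ) n) z = n) ∧
            ∀ t, β (mem (((PV d ℓ m K hd hL).sitesPerDir 0 : ℕ) : ℤ) n).hN (mem (((PV d ℓ m K hd hL).sitesPerDir 0 : ℕ) : ℤ) n).D
              (mem (((PV d ℓ m K hd hL).sitesPerDir 0 : ℕ) : ℤ) n).hk (ιBm (((PV d ℓ m K hd hL).sitesPerDir 0 : ℕ) : ℤ) n t) = t) ∧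
          ∀ (m K k : ℕ) (η : ℝ), 1 ≤ k → k + k₀ ≤ m + K → 0 < η →
            (∀ n, 1 ≤ n → n ≤ k → ∀ ⦃α₀ : ℝ⦄, 0 < α₀ → α₀ ≤ cL → ∀ U₀ : LSite (d + 1) → Fin (d + 1) → (Matrix (Fin N) (Fin N) ℂ)ˣ,
                (∀ x κ, U₀ x κ ∈ specialUnitaryUnits (Fin N)) →
                (∀ (x : LSite (d + 1)) (μ : Fin (d + 1)), U₀ (x + (((PV d ℓ m K hd hL).sitesPerDir 0 : ℕ) : ℤ) • e μ) = U₀ x) →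
                InAk (ℓ + 1) n η α₀ (fun _ => (Set.univ : Set (LSite (d + 1)))) U₀ →
                Nonempty (KnitCubeCore (mem (((PV d ℓ m K hd hL).sitesPerDir 0 : ℕ) : ℤ) n)
                  (bgY (mem (((PV d ℓ m K hd hL).sitesPerDir 0 : ℕ) : ℤ) n) U₀) b (ιBm (((PV d ℓ m K hd hL).sitesPerDir 0 : ℕ) : ℤ) n) Rr Hp p)) →
            (∀ m', m' ≤ k → ∀ ⦃α₀ : ℝ⦄, 0 < α₀ → α₀ ≤ cL → ∀ U₀ : LSite (d + 1) → Fin (d + 1) → (Matrix (Fin N) (Fin N) ℂ)ˣ,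
                (∀ x κ, U₀ x κ ∈ specialUnitaryUnits (Fin N)) →
                (∀ (x : LSite (d + 1)) (μ : Fin (d + 1)), U₀ (x + (((PV d ℓ m K hd hL).sitesPerDir 0 : ℕ) : ℤ) • e μ) = U₀ x) →
                InAk (ℓ + 1) m' η α₀ (fun _ => (Set.univ : Set (LSite (d + 1)))) U₀ →
                B9P3PerAt (𝔸 := Matrix (Fin N) (Fin N) ℂ) (ℓ + 1) B₀ B₀β cB9 βH len η m' α₀ (((PV d ℓ m K hd hL).sitesPerDir 0 : ℕ) : ℤ) U₀) →
            Thm2SetupSUAt (PV d ℓ m K hd hL) N k η 0 B₁ B₂ c₁ len (fun _ => True) := by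
  letI : CStarAlgebra (Matrix (Fin N) (Fin N) ℂ) := {}
  obtain ⟨θs, ℓs, Ds, cL, A, δG, δ₀, hθs, hℓs, hcL, hA, hδG, hδGc, hδ₀, hδ₀C, H⟩ :=
    thm2SetupSUAt_catalogued_exists_of_constants (d := d) (ℓ := ℓ) (hd := hd) (hL := hL) (b₀ := b₀) (b₁ := b₁) (len := len) (B₀β := B₀β)
      (βH := βH) hN hd2 hℓ hb₀ hb₁ hB₀ hB hcB9 b hM₂ hrepr hBG₀ hδG₀ hNG hNG' hAE hAc hδc hBC hδC hNn hκD Rr Hp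
  refine ⟨θs, ℓs, Ds, cL, A, δG, δ₀, hθs, hℓs, hcL, hA, hδG, hδGc, hδ₀, hδ₀C, fun θG ℓ₀ ℓ₁ Dsep h1 h2 h3 h4 h5 h6 h7 => ?_⟩
  obtain ⟨p, hspec, k₀, mem, ιBm, B₁, B₂, c₁, hB₁, hB₂, hc₁, hcat, hend⟩ := H θG ℓ₀ ℓ₁ Dsep h1 h2 h3 h4 h5 h6 h7
  refine ⟨p, hspec, k₀, mem, ιBm, B₁, B₂, c₁, hB₁, hB₂, hc₁, hcat, fun m K k η hk hkT hη hanC hb9 =>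
    hend m K k η hk hkT hη (fun n hn hnk α₀ hα hαc U₀ hG hper hAk => ?_) hb9⟩
  obtain ⟨-, -, -, hcf, -, hι⟩ := hcat m K n hn (by omega)
  obtain ⟨core⟩ := hanC n hn hnk hα hαc U₀ hG hper hAk
  exact ⟨KnitCubeAnalytic.ofCore hι hcf core⟩

end Endpoint

/-! ## §3 ★★★★★★★ The consumer's binder with the core cube data displayed -/

section Binder

variable {hd₃ : 1 ≤ 2 + 1}
variable [instF : ∀ i : KIdx 2 ℓ hd₃ hL b₀ b₁, Fintype (geo9K i).Site] [∀ i : KIdx 2 ℓ hd₃ hL b₀ b₁, DecidableEq (geo9K i).Site]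

/-- ★★★★★★★ **THE `hThm2` BINDER OF THE 19200 DICTIONARY, FROM THE CORE CUBE DATA AND THE (B)-LINES, FOR THE FAMILIES WITH `k₀ ≤ F.m`** — file A13's
`hThm2_of_constants` with `Nonempty (KnitCubeCore …)` per member: ∀ `F : T3Family` with `F.L = ℓ + 1` and `k₀ ≤ F.m`, ∀ `n < K`: [B9] Thm-3.7 ∕ Thm-3.9
cube data at the members `mem P₀ j`, `j ≤ K − n`, every `SU(2)`-valued `P₀`-periodic `U₀ ∈ 𝔄_j(T_η, α₀)`, `α₀ ≤ c_L`, `η = L^{−(K−n)}` → (B)-lines →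
`∃ β₀ B₂′ len′, Thm2SetupSUAt (F.P K) 2 (K − n) (eta F n K) β₀ B₁ B₂′ c₁ len′ (fun _ => True)`, `B₁, c₁` uniform.  Antecedents and the volume threshold
displayed, inhabited by nothing here; no estimate of [B8]∕[B9] proved; `stub_PV3A` NOT discharged; the Yang–Mills mass gap is NOT proved.
[cite: Balaban1985RegularSpaces, Thm 2 p.83; Balaban1985UV3, (1)–(3) p.256; Balaban1985Variational, (2), (5) p.278; Balaban1985BackgroundPropagators, Thm 3.7 p.410, Thm 3.9 p.413; Balaban1984PropagatorsII, (2.1)–(2.4) p.224, Lemma 2.1 p.234] -/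
theorem hThm2_of_core (hℓ : 4 ≤ ℓ) (hb₀ : 0 < b₀) (hb₁ : b₀ ≤ b₁)
    {B₀ B₀β cB9 βH : ℝ} {len : LSite (2 + 1) → ℝ}
    (hB₀ : 0 < B₀) (hB : 2 ≤ 5 * ((2 + 1 : ℕ) : ℝ) * ((ℓ + 1 : ℕ) : ℝ) * B₀) (hcB9 : 0 < cB9)
    {ι : Type} [Fintype ι] [DecidableEq ι] (b : Module.Basis ι ℝ (Matrix (Fin 2) (Fin 2) ℂ)) {M₂ : ℝ} (hM₂ : 0 ≤ M₂)
    (hrepr : ∀ (v : Matrix (Fin 2) (Fin 2) ℂ) (j : ι), |b.repr v j| ≤ M₂ * ‖v‖)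
    {BG₀ δG₀ NG NG' AE Ac δc BC δC Nn κD : ℝ} (hBG₀ : 0 ≤ BG₀) (hδG₀ : 0 < δG₀) (hNG : 0 ≤ NG) (hNG' : 0 ≤ NG')
    (hAE : 0 ≤ AE) (hAc : 0 ≤ Ac) (hδc : 0 < δc) (hBC : 0 ≤ BC) (hδC : 0 < δC) (hNn : 0 ≤ Nn) (hκD : 0 ≤ κD) (Rr : ℝ) (Hp : Prop) :
    letI : CStarAlgebra (Matrix (Fin 2) (Fin 2) ℂ) := {}
    ∃ θs ℓs Ds cL A δG δ₀ : ℝ, 0 < θs ∧ 0 < ℓs ∧ 0 < cL ∧ Ac ≤ A ∧ 0 < δG ∧ δG ≤ δc ∧ 0 < δ₀ ∧ δ₀ ≤ δC ∧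
      ∀ θG ℓ₀ ℓ₁ Dsep : ℝ, 0 ≤ θG → θG ≤ θs → 0 ≤ ℓ₀ → ℓ₀ ≤ ℓs → 0 ≤ ℓ₁ → ℓ₁ ≤ ℓs → Ds ≤ Dsep →
        ∃ p : KnitCubeParams,
          (p.BG₀ = BG₀ ∧ p.δG₀ = δG₀ ∧ p.NG = NG ∧ p.NG' = NG' ∧ p.AE = AE ∧ p.θG = θG ∧ p.A = A ∧ p.δG = δG ∧
            p.B₀ = BC ∧ p.δ₀ = δ₀ ∧ p.bb = 1 ∧ p.aD = 1 ∧ p.Nn = Nn ∧ p.κD = κD ∧ p.Dsep = Dsep ∧ p.ℓ₀ = ℓ₀ ∧ p.ℓ₁ = ℓ₁) ∧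
        ∃ (k₀ : ℕ) (mem : ℤ → ℕ → KIdx 2 ℓ hd₃ hL b₀ b₁) (ιBm : ∀ P n, BlkY (mem P n) → IBondY (mem P n)) (B₁ B₂ c₁ : ℝ),
          0 < B₁ ∧ 0 < B₂ ∧ 0 < c₁ ∧
          (∀ (m K n : ℕ), 1 ≤ n → n + k₀ ≤ m + K →
            (mem (((PV 2 ℓ m K hd₃ hL).sitesPerDir 0 : ℕ) : ℤ) n).m = m + K ∧ (mem (((PV 2 ℓ m K hd₃ hL).sitesPerDir 0 : ℕ) : ℤ) n).K = 0 ∧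
            (mem (((PV 2 ℓ m K hd₃ hL).sitesPerDir 0 : ℕ) : ℤ) n).k = n + 1 ∧
            (mem (((PV 2 ℓ m K hd₃ hL).sitesPerDir 0 : ℕ) : ℤ) n).cf = (((ℓ + 1 : ℕ) : ℝ)) ^ (mem (((PV 2 ℓ m K hd₃ hL).sitesPerDir 0 : ℕ) : ℤ) n).k ∧
            (∀ z : SiteY (mem (((PV 2 ℓ m K hd₃ hL).sitesPerDir 0 : ℕ) : ℤ) n), levY (mem (((PV 2 ℓ m K hd₃ hL).sitesPerDir 0 : ℕ) : ℤ) n) z = n) ∧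
            ∀ t, β (mem (((PV 2 ℓ m K hd₃ hL).sitesPerDir 0 : ℕ) : ℤ) n).hN (mem (((PV 2 ℓ m K hd₃ hL).sitesPerDir 0 : ℕ) : ℤ) n).D
              (mem (((PV 2 ℓ m K hd₃ hL).sitesPerDir 0 : ℕ) : ℤ) n).hk (ιBm (((PV 2 ℓ m K hd₃ hL).sitesPerDir 0 : ℕ) : ℤ) n t) = t) ∧
          ∀ F : T3Family, F.L = ℓ + 1 → k₀ ≤ F.m → ∀ (n K : ℕ), n < K →
            (∀ j, 1 ≤ j → j ≤ K - n → ∀ ⦃α₀ : ℝ⦄, 0 < α₀ → α₀ ≤ cL → ∀ U₀ : LSite (2 + 1) → Fin (2 + 1) → (Matrix (Fin 2) (Fin 2) ℂ)ˣ,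
                (∀ x κ, U₀ x κ ∈ specialUnitaryUnits (Fin 2)) →
                (∀ (x : LSite (2 + 1)) (μ : Fin (2 + 1)), U₀ (x + (((PV 2 ℓ F.m K hd₃ hL).sitesPerDir 0 : ℕ) : ℤ) • e μ) = U₀ x) →
                InAk (ℓ + 1) j (eta F n K) α₀ (fun _ => (Set.univ : Set (LSite (2 + 1)))) U₀ →
                Nonempty (KnitCubeCore (mem (((PV 2 ℓ F.m K hd₃ hL).sitesPerDir 0 : ℕ) : ℤ) j)
                  (bgY (mem (((PV 2 ℓ F.m K hd₃ hL).sitesPerDir 0 : ℕ) : ℤ) j) U₀) b (ιBm (((PV 2 ℓ F.m K hd₃ hL).sitesPerDir 0 : ℕ) : ℤ) j) Rr Hp p)) →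
            (∀ m', m' ≤ K - n → ∀ ⦃α₀ : ℝ⦄, 0 < α₀ → α₀ ≤ cL → ∀ U₀ : LSite (2 + 1) → Fin (2 + 1) → (Matrix (Fin 2) (Fin 2) ℂ)ˣ,
                (∀ x κ, U₀ x κ ∈ specialUnitaryUnits (Fin 2)) →
                (∀ (x : LSite (2 + 1)) (μ : Fin (2 + 1)), U₀ (x + (((PV 2 ℓ F.m K hd₃ hL).sitesPerDir 0 : ℕ) : ℤ) • e μ) = U₀ x) →
                InAk (ℓ + 1) m' (eta F n K) α₀ (fun _ => (Set.univ : Set (LSite (2 + 1)))) U₀ →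
                B9P3PerAt (𝔸 := Matrix (Fin 2) (Fin 2) ℂ) (ℓ + 1) B₀ B₀β cB9 βH len (eta F n K) m' α₀ (((PV 2 ℓ F.m K hd₃ hL).sitesPerDir 0 : ℕ) : ℤ) U₀) →
            ∃ (β₀ B₂' : ℝ) (len' : LSite (F.P K).d → ℝ),
              Thm2SetupSUAt (F.P K) 2 (K - n) (eta F n K) β₀ B₁ B₂' c₁ len' (fun _ => True) := by
  letI : CStarAlgebra (Matrix (Fin 2) (Fin 2) ℂ) := {}
  obtain ⟨θs, ℓs, Ds, cL, A, δG, δ₀, hθs, hℓs, hcL, hA, hδG, hδGc, hδ₀, hδ₀C, H⟩ :=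
    thm2SetupSUAt_catalogued_exists_of_core (d := 2) (ℓ := ℓ) (hd := hd₃) (hL := hL) (b₀ := b₀) (b₁ := b₁) (len := len) (B₀β := B₀β)
      (βH := βH) (by norm_num) (by norm_num) hℓ hb₀ hb₁ hB₀ hB hcB9 b hM₂ hrepr hBG₀ hδG₀ hNG hNG' hAE hAc hδc hBC hδC hNn hκD Rr Hp
  refine ⟨θs, ℓs, Ds, cL, A, δG, δ₀, hθs, hℓs, hcL, hA, hδG, hδGc, hδ₀, hδ₀C, fun θG ℓ₀ ℓ₁ Dsep h1 h2 h3 h4 h5 h6 h7 => ?_⟩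
  obtain ⟨p, hspec, k₀, mem, ιBm, B₁, B₂, c₁, hB₁, hB₂, hc₁, hcat, hend⟩ := H θG ℓ₀ ℓ₁ Dsep h1 h2 h3 h4 h5 h6 h7
  refine ⟨p, hspec, k₀, mem, ιBm, B₁, B₂, c₁, hB₁, hB₂, hc₁, hcat, fun F hF hm n K hnK han hb9 => ?_⟩
  have hT := hend F.m K (K - n) (eta F n K) (by omega) (by omega) (eta_pos F n K) han hb9
  rw [P_eq_PV (hd := hd₃) (hL := hL) F hF K]
  exact ⟨0, B₂, len, hT⟩

end Binder

end Literature.MathematicalPhysics.QuantumFieldTheory.Balaban1983to89.B8Thm2TorusKnitCubeCore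

end
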